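import Mathlib.LinearAlgebra.Matrix.Rank
import Mathlib.LinearAlgebra.Matrix.NonsingularInverse
import Mathlib.Algebra.Polynomial.Basic
import HarnessLib

/-!
# The rank invariants of a matrix multiplication scheme (Heule–Kauers–Seidl 2021, §4)

Topic `Literature/Computability/AlgebraicComplexity`. Source: M. J. H. Heule, M. Kauers, M. Seidl,
*New ways to multiply 3 × 3-matrices*, J. Symbolic Comput. 104 (2021) 899–916 = arXiv:1905.10192
(HKS), §4. The symmetry group: "A permutation `π ∈ S₃` acts on a tensor `A⊗B⊗C` by permuting the
three factors, and transposing each of them if `sgn(π) = −1`. For example,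
`(1 2)·(A⊗B⊗C) = Bᵀ⊗Aᵀ⊗Cᵀ` and `(1 2 3)·(A⊗B⊗C) = B⊗C⊗A`. A triple `(U,V,W) ∈ GL(K,3)³` of
invertible matrices acts via `(U,V,W)·(A⊗B⊗C) = UAV⁻¹ ⊗ VBW⁻¹ ⊗ WCU⁻¹`." The invariants:
"since permutation and multiplication by invertible matrices do not change the rank of a
matrix, we can count how many matrices of rank 1, 2, and 3 appear in the scheme. … Writing a
scheme in the form `Σ_{ℓ=1}^{23} (A_ℓ⊗B_ℓ⊗C_ℓ)`, we can encode this invariant as the polynomial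
`Σ_{ℓ=1}^{23} (x^{rank(A_ℓ)} + x^{rank(B_ℓ)} + x^{rank(C_ℓ)})`. Similarly, also the polynomials
`Σ_{ℓ=1}^{23} x^{rank(A_ℓ)+rank(B_ℓ)+rank(C_ℓ)}` and
`x^{Σ_ℓ rank(A_ℓ)} + x^{Σ_ℓ rank(B_ℓ)} + x^{Σ_ℓ rank(C_ℓ)}` are invariants, because changing the
order of summation does not affect the relative order of the factors in the tensor, and applying
a permutation changes the relative order of the factors in every summand in the same way."
Everything here is PROVED, for families of `n × n` matrices over any field indexed by any finite
type (HKS: `n = 3`, `23` summands); no named facts.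

## What is typed

* `inv₁`, `inv₂`, `inv₃` — the three printed polynomials (in `ℕ[X]`) of a scheme written as a
  family `ℓ ↦ (A_ℓ, B_ℓ, C_ℓ)`.
* Invariance under the printed generators of `G = GL(K,n)³ × S₃` and under reordering the
  summands: the sandwich `(U,V,W)` (`inv₁/₂/₃_sandwich`, via `rank_sandwich`:
  `rank(U A V⁻¹) = rank A`), the transposition `(1 2)` (`inv₁/₂/₃_swap₁₂`: `(A,B,C) ↦ (Bᵀ,Aᵀ,Cᵀ)`),
  the cycle `(1 2 3)` (`inv₁/₂/₃_cycle`: `(A,B,C) ↦ (B,C,A)`), and any bijective reindexing of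
  the summands (`inv₁/₂/₃_reindex`); bundled as `heuleKauersSeidl2021_rank_invariants`.

Scope note. The statements are about the factor MATRICES of a scheme presented as a family (the
form in which HKS compute them); correctness of the scheme plays no role in the invariance. The
tree's tensor-level symmetry group (`FlipGraph.InSymmetryGroup`, `FlipGraphEquivariance.lean`) is
generated by the same three kinds of maps.

## References

* M. J. H. Heule, M. Kauers, M. Seidl, *New ways to multiply 3 × 3-matrices*, J. Symbolic
  Comput. 104 (2021) 899–916, doi:10.1016/j.jsc.2020.10.003, arXiv:1905.10192, §4 (the group `G`
  and the three invariants). [HeuleKauersSeidl2021]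
-/

namespace Literature.Computability.AlgebraicComplexity

open scoped BigOperators
open Polynomial Matrix

namespace SchemeRankInvariants

variable {K : Type*} [Field K] {n : ℕ} {σ : Type*} [Fintype σ]

/-- **HKS's first invariant** `Σ_ℓ (x^{rank A_ℓ} + x^{rank B_ℓ} + x^{rank C_ℓ})` — "how many
matrices of rank 1, 2, and 3 appear in the scheme". [cite: HeuleKauersSeidl2021, §4 (invariants)] -/
noncomputable def inv₁ (A B C : σ → Matrix (Fin n) (Fin n) K) : ℕ[X] :=
  ∑ ℓ, (X ^ (A ℓ).rank + X ^ (B ℓ).rank + X ^ (C ℓ).rank)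

/-- **HKS's second invariant** `Σ_ℓ x^{rank A_ℓ + rank B_ℓ + rank C_ℓ}`.
[cite: HeuleKauersSeidl2021, §4 (invariants)] -/
noncomputable def inv₂ (A B C : σ → Matrix (Fin n) (Fin n) K) : ℕ[X] :=
  ∑ ℓ, X ^ ((A ℓ).rank + (B ℓ).rank + (C ℓ).rank)

/-- **HKS's third invariant** `x^{Σ_ℓ rank A_ℓ} + x^{Σ_ℓ rank B_ℓ} + x^{Σ_ℓ rank C_ℓ}`.
[cite: HeuleKauersSeidl2021, §4 (invariants)] -/
noncomputable def inv₃ (A B C : σ → Matrix (Fin n) (Fin n) K) : ℕ[X] :=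
  X ^ (∑ ℓ, (A ℓ).rank) + X ^ (∑ ℓ, (B ℓ).rank) + X ^ (∑ ℓ, (C ℓ).rank)

/-! ## "Multiplication by invertible matrices does not change the rank" -/

/-- `rank (U M V⁻¹) = rank M` for invertible `U, V`.
[cite: HeuleKauersSeidl2021, §4 ("multiplication by invertible matrices do[es] not change the rank")] -/
theorem rank_sandwich {U V : Matrix (Fin n) (Fin n) K} (hU : IsUnit U.det) (hV : IsUnit V.det)
    (M : Matrix (Fin n) (Fin n) K) : (U * M * V⁻¹).rank = M.rank := by
  rw [rank_mul_eq_left_of_isUnit_det V⁻¹ (U * M) (isUnit_nonsing_inv_det V hV),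
    rank_mul_eq_right_of_isUnit_det U M hU]

variable (A B C : σ → Matrix (Fin n) (Fin n) K)

/-- **The sandwich `(U,V,W)·(A⊗B⊗C) = UAV⁻¹ ⊗ VBW⁻¹ ⊗ WCU⁻¹` preserves the first invariant.**
[cite: HeuleKauersSeidl2021, §4] -/
theorem inv₁_sandwich {U V W : Matrix (Fin n) (Fin n) K} (hU : IsUnit U.det) (hV : IsUnit V.det)
    (hW : IsUnit W.det) :
    inv₁ (fun ℓ => U * A ℓ * V⁻¹) (fun ℓ => V * B ℓ * W⁻¹) (fun ℓ => W * C ℓ * U⁻¹) = inv₁ A B C := by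
  simp only [inv₁, rank_sandwich hU hV, rank_sandwich hV hW, rank_sandwich hW hU]

/-- The sandwich preserves the second invariant. [cite: HeuleKauersSeidl2021, §4] -/
theorem inv₂_sandwich {U V W : Matrix (Fin n) (Fin n) K} (hU : IsUnit U.det) (hV : IsUnit V.det)
    (hW : IsUnit W.det) :
    inv₂ (fun ℓ => U * A ℓ * V⁻¹) (fun ℓ => V * B ℓ * W⁻¹) (fun ℓ => W * C ℓ * U⁻¹) = inv₂ A B C := by
  simp only [inv₂, rank_sandwich hU hV, rank_sandwich hV hW, rank_sandwich hW hU]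

/-- The sandwich preserves the third invariant. [cite: HeuleKauersSeidl2021, §4] -/
theorem inv₃_sandwich {U V W : Matrix (Fin n) (Fin n) K} (hU : IsUnit U.det) (hV : IsUnit V.det)
    (hW : IsUnit W.det) :
    inv₃ (fun ℓ => U * A ℓ * V⁻¹) (fun ℓ => V * B ℓ * W⁻¹) (fun ℓ => W * C ℓ * U⁻¹) = inv₃ A B C := by
  simp only [inv₃, rank_sandwich hU hV, rank_sandwich hV hW, rank_sandwich hW hU]

/-! ## "Permutation [with transposition] does not change the rank … and changes the relative
order of the factors in every summand in the same way" -/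

/-- **The transposition `(1 2)·(A⊗B⊗C) = Bᵀ⊗Aᵀ⊗Cᵀ` preserves the first invariant.**
[cite: HeuleKauersSeidl2021, §4] -/
theorem inv₁_swap₁₂ :
    inv₁ (fun ℓ => (B ℓ)ᵀ) (fun ℓ => (A ℓ)ᵀ) (fun ℓ => (C ℓ)ᵀ) = inv₁ A B C := by
  simp only [inv₁, rank_transpose]
  exact Finset.sum_congr rfl fun ℓ _ => by ring

/-- `(1 2)` preserves the second invariant. [cite: HeuleKauersSeidl2021, §4] -/
theorem inv₂_swap₁₂ :
    inv₂ (fun ℓ => (B ℓ)ᵀ) (fun ℓ => (A ℓ)ᵀ) (fun ℓ => (C ℓ)ᵀ) = inv₂ A B C := by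
  simp only [inv₂, rank_transpose]
  exact Finset.sum_congr rfl fun ℓ _ => by ring_nf

/-- `(1 2)` preserves the third invariant. [cite: HeuleKauersSeidl2021, §4] -/
theorem inv₃_swap₁₂ :
    inv₃ (fun ℓ => (B ℓ)ᵀ) (fun ℓ => (A ℓ)ᵀ) (fun ℓ => (C ℓ)ᵀ) = inv₃ A B C := by
  simp only [inv₃, rank_transpose]
  ring

/-- **The cycle `(1 2 3)·(A⊗B⊗C) = B⊗C⊗A` preserves the first invariant.**
[cite: HeuleKauersSeidl2021, §4] -/
theorem inv₁_cycle : inv₁ B C A = inv₁ A B C := by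
  simp only [inv₁]
  exact Finset.sum_congr rfl fun ℓ _ => by ring

/-- `(1 2 3)` preserves the second invariant. [cite: HeuleKauersSeidl2021, §4] -/
theorem inv₂_cycle : inv₂ B C A = inv₂ A B C := by
  simp only [inv₂]
  exact Finset.sum_congr rfl fun ℓ _ => by ring_nf

/-- `(1 2 3)` preserves the third invariant. [cite: HeuleKauersSeidl2021, §4] -/
theorem inv₃_cycle : inv₃ B C A = inv₃ A B C := by
  simp only [inv₃]
  ring

/-! ## "Changing the order of summation does not affect [the invariants]" -/

variable {σ' : Type*} [Fintype σ']

/-- **Reordering the summands preserves the first invariant** (reindexing along a bijection).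
[cite: HeuleKauersSeidl2021, §4] -/
theorem inv₁_reindex (e : σ' ≃ σ) :
    inv₁ (fun ℓ => A (e ℓ)) (fun ℓ => B (e ℓ)) (fun ℓ => C (e ℓ)) = inv₁ A B C :=
  Fintype.sum_equiv e _ _ fun _ => rfl

/-- Reordering the summands preserves the second invariant. [cite: HeuleKauersSeidl2021, §4] -/
theorem inv₂_reindex (e : σ' ≃ σ) :
    inv₂ (fun ℓ => A (e ℓ)) (fun ℓ => B (e ℓ)) (fun ℓ => C (e ℓ)) = inv₂ A B C :=
  Fintype.sum_equiv e _ _ fun _ => rfl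

/-- Reordering the summands preserves the third invariant. [cite: HeuleKauersSeidl2021, §4] -/
theorem inv₃_reindex (e : σ' ≃ σ) :
    inv₃ (fun ℓ => A (e ℓ)) (fun ℓ => B (e ℓ)) (fun ℓ => C (e ℓ)) = inv₃ A B C := by
  simp only [inv₃, Fintype.sum_equiv e (fun ℓ => (A (e ℓ)).rank) (fun ℓ => (A ℓ).rank) fun _ => rfl,
    Fintype.sum_equiv e (fun ℓ => (B (e ℓ)).rank) (fun ℓ => (B ℓ).rank) fun _ => rfl,
    Fintype.sum_equiv e (fun ℓ => (C (e ℓ)).rank) (fun ℓ => (C ℓ).rank) fun _ => rfl]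

/-- **HKS 2021 §4: the three polynomials are invariants of the action of `G = GL(K,n)³ × S₃`
(and of reordering the summands)** — invariance under the printed generators: every sandwich
`(U,V,W)`, the transposition `(1 2)` (with transposes), the cycle `(1 2 3)`, and every bijective
reindexing. [cite: HeuleKauersSeidl2021, §4 (invariants)] -/
theorem heuleKauersSeidl2021_rank_invariants :
    (∀ (U V W : Matrix (Fin n) (Fin n) K), IsUnit U.det → IsUnit V.det → IsUnit W.det →
      inv₁ (fun ℓ => U * A ℓ * V⁻¹) (fun ℓ => V * B ℓ * W⁻¹) (fun ℓ => W * C ℓ * U⁻¹) = inv₁ A B C ∧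
      inv₂ (fun ℓ => U * A ℓ * V⁻¹) (fun ℓ => V * B ℓ * W⁻¹) (fun ℓ => W * C ℓ * U⁻¹) = inv₂ A B C ∧
      inv₃ (fun ℓ => U * A ℓ * V⁻¹) (fun ℓ => V * B ℓ * W⁻¹) (fun ℓ => W * C ℓ * U⁻¹) = inv₃ A B C) ∧
    (inv₁ (fun ℓ => (B ℓ)ᵀ) (fun ℓ => (A ℓ)ᵀ) (fun ℓ => (C ℓ)ᵀ) = inv₁ A B C ∧
      inv₂ (fun ℓ => (B ℓ)ᵀ) (fun ℓ => (A ℓ)ᵀ) (fun ℓ => (C ℓ)ᵀ) = inv₂ A B C ∧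
      inv₃ (fun ℓ => (B ℓ)ᵀ) (fun ℓ => (A ℓ)ᵀ) (fun ℓ => (C ℓ)ᵀ) = inv₃ A B C) ∧
    (inv₁ B C A = inv₁ A B C ∧ inv₂ B C A = inv₂ A B C ∧ inv₃ B C A = inv₃ A B C) ∧
    (∀ e : σ' ≃ σ,
      inv₁ (fun ℓ => A (e ℓ)) (fun ℓ => B (e ℓ)) (fun ℓ => C (e ℓ)) = inv₁ A B C ∧
      inv₂ (fun ℓ => A (e ℓ)) (fun ℓ => B (e ℓ)) (fun ℓ => C (e ℓ)) = inv₂ A B C ∧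
      inv₃ (fun ℓ => A (e ℓ)) (fun ℓ => B (e ℓ)) (fun ℓ => C (e ℓ)) = inv₃ A B C) :=
  ⟨fun _ _ _ hU hV hW => ⟨inv₁_sandwich A B C hU hV hW, inv₂_sandwich A B C hU hV hW,
      inv₃_sandwich A B C hU hV hW⟩,
    ⟨inv₁_swap₁₂ A B C, inv₂_swap₁₂ A B C, inv₃_swap₁₂ A B C⟩,
    ⟨inv₁_cycle A B C, inv₂_cycle A B C, inv₃_cycle A B C⟩,
    fun e => ⟨inv₁_reindex A B C e, inv₂_reindex A B C e, inv₃_reindex A B C e⟩⟩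

end SchemeRankInvariants

end Literature.Computability.AlgebraicComplexity
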